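import Summits.CriticalPhenomena.PercolationContinuityZ3.Theses.PercFoamCut

/-!
# `Lines/birth.lean` — birth skeleton for crux `PercFoamCut.MacroCutLog`
(item stmt-CriticalPhenomena-5333 · route route-CriticalPhenomena-PercFoamCut ·
sub-problem `PercolationContinuityZ3` · skeleton-register by
planner-skel-stmt-CriticalPhenomena-5333-0, 2026-08-17)

**Crux (rank 2, ANTI-FOAM).** `MacroCutLog`: for bond percolation on `ℤ³`, at every `p` with
`θ(p) > 0` and for every density `a > 0` there is `c > 0` such that
`P_p(∃ A ⊆ C_∞ ∩ Λ_n : |A| ≥ a|Λ_n|, |C_∞ ∩ Λ_n ∖ A| ≥ a|Λ_n|, #{open edges leaving A} ≤ c n²/log n) → 0`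
(`Λ_n = box 3 n`, `|Λ_n| = (2n+1)³`; open edges with exactly one endpoint in `A` are counted,
wherever they go).  A theorem for `p > p_c` (Kesten–Zhang / Pete 2008 Cor. 1.3); the content is
the hypothetical percolating `p = p_c`.

**The skeleton** is the honest cut of the route's own engine (support `KGivesMacroCutLog`,
Hutchcroft arXiv:2207.05226 Rem. 1.2 + Pete 2008 §1) along the probability / combinatorics seam:

* `stub_connectedIsoperimetry` — the PROBABILISTIC HALF, a same-`p` in-box isoperimetric profile
  of the infinite cluster with a logarithmic loss: at every `p` with `θ(p) > 0` there is `κ > 0`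
  such that, with probability `→ 1`, every OPEN-CONNECTED set `S ⊆ C_∞ ∩ Λ_n` of at least `n`
  vertices has more than `κ |S|^{2/3} / log n` open edges leaving it.  This is Pete 2008 Cor. 1.3
  (`Literature.Probability.Percolation.Pete2008_cor13`, threshold `c₃ (log n)^{3/2} ≤ n`, bound
  `α|S|^{2/3}`) weakened by the factor `log n` and moved from `p > p_c` to "every `p` with
  `θ(p) > 0`"; p-blind it follows from the Kesten–Zhang tail at the same `p`
  (`PercFoamCut.FiniteClusterVolumeTail`, crux stmt-CriticalPhenomena-0943) by the union bound of
  arXiv:2207.05226 Rem. 1.2 (close the `≤ κ t^{2/3}/log n` open boundary edges of `S ∋ v`: the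
  cluster of `v` becomes `S`; `(b+1)·C(6t,b)·(p/(1-p))^b = exp(o(t^{2/3}))` preimages; sum over
  `v ∈ Λ_n`, `t ≥ n`).  All the open-problem content of the crux sits here, in MESOSCOPIC,
  CONNECTED currency (sets of `≥ n` vertices, not `≥ a n³`; connected through open edges; no
  balance condition) — the currency in which cluster isoperimetry is proved in print.
* `stub_denseSetExits` — the DETERMINISTIC HALF (no probability): for `κ, a > 0` there are
  `c > 0`, `N` such that for `n ≥ N` and every configuration `ω ⊆ E(ℤ³)` satisfying the
  isoperimetric conclusion of stub 1 at scale `n`, EVERY `A ⊆ C_∞ ∩ Λ_n` with `|A| ≥ a(2n+1)³`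
  has more than `c n²/log n` open edges leaving it.  Proof on paper (Pete 2008 §1 / route
  support KGivesMacroCutLog (ii)): split `A` into the components `J_i` of the graph on `A` whose
  edges are the open lattice edges inside `A`; an open edge leaving `J_i` cannot end in `A`, so
  the open edge boundaries of the `J_i` are disjoint subsets of that of `A`, each non-empty
  (`J_i` is a finite proper part of an infinite open cluster): `#components ≤ f := #open ∂A`;
  components with `< n` vertices carry `< f·n` vertices; a component with `≥ n` vertices has
  `#open ∂J_i > κ|J_i|^{2/3}/log n ≥ κ|J_i|/((2n+1) log n)`, so the big ones carry
  `< (2n+1) log n · f/κ` vertices; hence `a(2n+1)³ ≤ |A| < f·(n + (2n+1) log n/κ)`, impossible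
  for `f ≤ c n²/log n` once `c ≤ min(a, κa)` and `n ≥ 3`.  Size M (finite combinatorics of
  open components + elementary asymptotics).
* `MacroCutLog_of` — the composition, kernel-checked and `sorry`-free: take `κ` from stub 1,
  `c, N` from stub 2; for `n ≥ N` the cheap-cut event is contained in
  `{isoperimetry fails at scale n} ∪ {ω ⊄ E(ℤ³)}`, the second set being `P_p`-null
  (`ProbabilityTheory.setBernoulli_ae_subset`); squeeze.  It concludes the crux BY NAME.

Neither stub alone gives the crux (stub 1 speaks of connected mesoscopic sets and needs the
component decomposition; stub 2 is a deterministic implication with no measure in it), and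
neither is the conjunct `θ(p_c) = 0` in disguise: the BC3 probes `stub → MacroCutLog` and
`stub → PercolationContinuityZ3` by `first | exact? | simpa | (unfold; simpa) | aesop`, and by each
alternative alone, all FAIL (4/4 batteries, 16/16 single tactics; details in `Lines/birth.md`).
The balance condition of the crux (`|C_∞ ∩ Λ_n ∖ A| ≥ a|Λ_n|`) is not used by the composition —
with a `log`-weakened budget even the full trace `C_∞ ∩ Λ_n` has `≍ n²` exits through `∂Λ_n`, so
the density of `A` alone forces `> c n²/log n` exits; the balance only matters for the exact-order
sibling `MacroCutQuadratic`.

Disproof / negatives honoured: `Cruxes/MacroCutLog/` had no workfiles before this one (no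
`Disproof.lean`, no `_false_without_` theorem, no landed `Theorems/MacroCutLog/Negative/*`);
`ledger negatives --problem CriticalPhenomena` has no in-box isoperimetry / cut statement.  The
refuter's read-back of the crux (junk only at `n ≤ 1` where `log n = 0`; `a ≥ 1/2` empty) is
respected: both stubs are asymptotic in `n` (`Tendsto` / `∃ N`), and `Real.log n` appears only
as it does in the crux.

Layout: §0 the two stub statements as name-keyed `Prop`s `__Registered.stub_*` (the device of
`Cruxes/BGNOffTheFloor/Lines/birth.lean` and `Cruxes/FiniteClusterVolumeTail/Lines/birth.lean`: an
implementation-detail namespace, so the native skeleton audit `#h21_check_skeleton` resolves the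
stub NAMES to the sorried theorems of §1 and admits the hypotheses of `MacroCutLog_of` by stub
name) · §1 the two registered stubs `theorem stub_* : <spelled-out signature> := by sorry` (the
only `sorry`s) · §2 the composition
`MacroCutLog_of (h₁ : __Registered.stub_connectedIsoperimetry) (h₂ : __Registered.stub_denseSetExits) :
…PercFoamCut.MacroCutLog` (kernel-checked, `sorry`-free) · §3 definitional consistency.
-/

namespace Summit.CriticalPhenomena.PercolationContinuityZ3.Cruxes.MacroCutLog.Birth

open Literature.Probability.Percolation Literature.Probability.LatticeModels
open MeasureTheory Filter
open scoped Topology Classical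

/-! ## §0 The two stub statements, name-keyed (what `MacroCutLog_of` takes) -/

namespace __Registered

/-- Name-keyed statement of `stub_connectedIsoperimetry`: at every `p` with `θ(p) > 0` there is
`κ > 0` with `P_p(∃ S ⊆ C_∞ ∩ Λ_n open-connected, |S| ≥ n, #open ∂S ≤ κ|S|^{2/3}/log n) → 0`.
[stub statement; theorem for `p > p_c` (Pete2008 Cor. 1.3), open at a percolating `p_c`] -/
def stub_connectedIsoperimetry : Prop :=
  ∀ p : unitInterval, 0 < theta (zdGraph 3) 0 p → ∃ κ : ℝ, 0 < κ ∧
    Tendsto (fun n : ℕ => (bondPercolation (zdGraph 3) p).real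
      {ω | ∃ S : Finset (Site 3), S ⊆ box 3 n ∧ (∀ x ∈ S, ω ∈ percolatesAt x) ∧
        (∀ x ∈ S, ∀ y ∈ S, ω ∈ openConnIn (↑S : Set (Site 3)) x y) ∧
        (n : ℝ) ≤ (S.card : ℝ) ∧
        (((edgeBoundary (zdGraph 3) S).filter (fun e => e ∈ ω)).card : ℝ) ≤
          κ * (S.card : ℝ) ^ ((2 : ℝ) / 3) / Real.log (n : ℝ)}) atTop (𝓝 0)

/-- Name-keyed statement of `stub_denseSetExits`: deterministically, in-box isoperimetry of
open-connected percolating sets of `≥ n` vertices forces every `a`-dense `A ⊆ C_∞ ∩ Λ_n` to have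
`> c n²/log n` open edges leaving it (`n ≥ N(κ,a)`). [stub statement; provable now, size M] -/
def stub_denseSetExits : Prop :=
  ∀ κ a : ℝ, 0 < κ → 0 < a → ∃ c : ℝ, 0 < c ∧ ∃ N : ℕ, ∀ n : ℕ, N ≤ n →
    ∀ ω : BondConfig (Site 3), ω ⊆ (zdGraph 3).edgeSet →
      (∀ S : Finset (Site 3), S ⊆ box 3 n → (∀ x ∈ S, ω ∈ percolatesAt x) →
        (∀ x ∈ S, ∀ y ∈ S, ω ∈ openConnIn (↑S : Set (Site 3)) x y) →
        (n : ℝ) ≤ (S.card : ℝ) →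
        κ * (S.card : ℝ) ^ ((2 : ℝ) / 3) / Real.log (n : ℝ) <
          (((edgeBoundary (zdGraph 3) S).filter (fun e => e ∈ ω)).card : ℝ)) →
      ∀ A : Finset (Site 3), (∀ x ∈ A, x ∈ box 3 n ∧ ω ∈ percolatesAt x) →
        a * (2 * (n : ℝ) + 1) ^ 3 ≤ (A.card : ℝ) →
        c * (n : ℝ) ^ 2 / Real.log (n : ℝ) <
          (((edgeBoundary (zdGraph 3) A).filter (fun e => e ∈ ω)).card : ℝ)

end __Registered

/-! ## §1 Registered stubs (the only `sorry`s of the file) -/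

/-- **Stub 1 — SAME-`p` CONNECTED ISOPERIMETRY WITH A LOG LOSS (the probabilistic half; all the
open-problem content of the crux).**  For bond percolation on `ℤ³`, at every `p` with `θ(p) > 0`
there is `κ > 0` such that the probability that some open-connected `S ⊆ C_∞ ∩ Λ_n` with
`|S| ≥ n` has at most `κ |S|^{2/3} / log n` open edges leaving it tends to `0` as `n → ∞`.
For `p > p_c` this is Pete 2008 Cor. 1.3 (tree: `Pete2008_cor13`, a.s.-eventually, threshold
`c₃ (log n)^{3/2}`, bound `α|S|^{2/3}`) up to the harmless `log n`; p-blind it follows from the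
Kesten–Zhang tail at the same `p` (crux `PercFoamCut.FiniteClusterVolumeTail`) by Hutchcroft's
union bound (arXiv:2207.05226 Rem. 1.2).  Open exactly at a hypothetical percolating `p_c`. -/
theorem stub_connectedIsoperimetry :
    ∀ p : unitInterval, 0 < theta (zdGraph 3) 0 p → ∃ κ : ℝ, 0 < κ ∧
      Tendsto (fun n : ℕ => (bondPercolation (zdGraph 3) p).real
        {ω | ∃ S : Finset (Site 3), S ⊆ box 3 n ∧ (∀ x ∈ S, ω ∈ percolatesAt x) ∧
          (∀ x ∈ S, ∀ y ∈ S, ω ∈ openConnIn (↑S : Set (Site 3)) x y) ∧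
          (n : ℝ) ≤ (S.card : ℝ) ∧
          (((edgeBoundary (zdGraph 3) S).filter (fun e => e ∈ ω)).card : ℝ) ≤
            κ * (S.card : ℝ) ^ ((2 : ℝ) / 3) / Real.log (n : ℝ)}) atTop (𝓝 0) := by
  sorry

/-- **Stub 2 — DENSE SETS HAVE MANY EXITS (the deterministic half).**  For `κ, a > 0` there are
`c > 0` and `N` such that for every `n ≥ N` and every configuration `ω ⊆ E(ℤ³)` in which every
open-connected percolating `S ⊆ Λ_n` with `|S| ≥ n` has `> κ|S|^{2/3}/log n` open edges leaving
it, every `A ⊆ C_∞ ∩ Λ_n` with `|A| ≥ a(2n+1)³` has `> c n²/log n` open edges leaving it.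
Proof on paper: decompose `A` into the components of its open lattice edges; their open edge
boundaries are disjoint, non-empty, and contained in that of `A`; small components carry
`< f·n` vertices and big ones `< (2n+1) log n · f/κ`, `f = #open ∂A`; `c = min(a, κa)`, `N = 3`
work.  (Pete 2008 §1; route support `KGivesMacroCutLog` (ii).)  Provable now, size M. -/
theorem stub_denseSetExits :
    ∀ κ a : ℝ, 0 < κ → 0 < a → ∃ c : ℝ, 0 < c ∧ ∃ N : ℕ, ∀ n : ℕ, N ≤ n →
      ∀ ω : BondConfig (Site 3), ω ⊆ (zdGraph 3).edgeSet →
        (∀ S : Finset (Site 3), S ⊆ box 3 n → (∀ x ∈ S, ω ∈ percolatesAt x) →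
          (∀ x ∈ S, ∀ y ∈ S, ω ∈ openConnIn (↑S : Set (Site 3)) x y) →
          (n : ℝ) ≤ (S.card : ℝ) →
          κ * (S.card : ℝ) ^ ((2 : ℝ) / 3) / Real.log (n : ℝ) <
            (((edgeBoundary (zdGraph 3) S).filter (fun e => e ∈ ω)).card : ℝ)) →
        ∀ A : Finset (Site 3), (∀ x ∈ A, x ∈ box 3 n ∧ ω ∈ percolatesAt x) →
          a * (2 * (n : ℝ) + 1) ^ 3 ≤ (A.card : ℝ) →
          c * (n : ℝ) ^ 2 / Real.log (n : ℝ) <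
            (((edgeBoundary (zdGraph 3) A).filter (fun e => e ∈ ω)).card : ℝ) := by
  sorry

/-! ## §2 Composition (kernel-checked, no `sorry`): the two stubs give the crux by name -/

theorem MacroCutLog_of (h₁ : __Registered.stub_connectedIsoperimetry)
    (h₂ : __Registered.stub_denseSetExits) :
    Summit.CriticalPhenomena.PercolationContinuityZ3.Theses.PercFoamCut.MacroCutLog := by
  unfold Summit.CriticalPhenomena.PercolationContinuityZ3.Theses.PercFoamCut.MacroCutLog
  intro p hp a ha
  obtain ⟨κ, hκ, hT⟩ := h₁ p hp
  obtain ⟨c, hc, N, hN⟩ := h₂ κ a hκ ha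
  refine ⟨c, hc, ?_⟩
  -- almost surely every open edge is a lattice edge
  have hnull : (bondPercolation (zdGraph 3) p) {ω | ¬ ω ⊆ (zdGraph 3).edgeSet} = 0 :=
    ae_iff.1 (ProbabilityTheory.setBernoulli_ae_subset :
      ∀ᵐ ω ∂(bondPercolation (zdGraph 3) p), ω ⊆ (zdGraph 3).edgeSet)
  have hnull' : (bondPercolation (zdGraph 3) p).real {ω | ¬ ω ⊆ (zdGraph 3).edgeSet} = 0 := by
    rw [measureReal_def, hnull, ENNReal.toReal_zero]
  -- for `n ≥ N`, the cheap-cut event lies inside {isoperimetry fails} ∪ {non-lattice open edge}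
  have key : ∀ n : ℕ, N ≤ n →
      (bondPercolation (zdGraph 3) p).real
        {ω | ∃ A : Finset (Site 3), (∀ x ∈ A, x ∈ box 3 n ∧ ω ∈ percolatesAt x) ∧
          a * (2 * (n : ℝ) + 1) ^ 3 ≤ (A.card : ℝ) ∧
          a * (2 * (n : ℝ) + 1) ^ 3 ≤
            (((box 3 n).filter (fun x => ω ∈ percolatesAt x ∧ x ∉ A)).card : ℝ) ∧
          (((edgeBoundary (zdGraph 3) A).filter (fun e => e ∈ ω)).card : ℝ) ≤
            c * (n : ℝ) ^ 2 / Real.log (n : ℝ)} ≤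
      (bondPercolation (zdGraph 3) p).real
        {ω | ∃ S : Finset (Site 3), S ⊆ box 3 n ∧ (∀ x ∈ S, ω ∈ percolatesAt x) ∧
          (∀ x ∈ S, ∀ y ∈ S, ω ∈ openConnIn (↑S : Set (Site 3)) x y) ∧
          (n : ℝ) ≤ (S.card : ℝ) ∧
          (((edgeBoundary (zdGraph 3) S).filter (fun e => e ∈ ω)).card : ℝ) ≤
            κ * (S.card : ℝ) ^ ((2 : ℝ) / 3) / Real.log (n : ℝ)} := by
    intro n hn
    have hsub :
        {ω : BondConfig (Site 3) | ∃ A : Finset (Site 3),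
          (∀ x ∈ A, x ∈ box 3 n ∧ ω ∈ percolatesAt x) ∧
          a * (2 * (n : ℝ) + 1) ^ 3 ≤ (A.card : ℝ) ∧
          a * (2 * (n : ℝ) + 1) ^ 3 ≤
            (((box 3 n).filter (fun x => ω ∈ percolatesAt x ∧ x ∉ A)).card : ℝ) ∧
          (((edgeBoundary (zdGraph 3) A).filter (fun e => e ∈ ω)).card : ℝ) ≤
            c * (n : ℝ) ^ 2 / Real.log (n : ℝ)} ⊆
        {ω | ∃ S : Finset (Site 3), S ⊆ box 3 n ∧ (∀ x ∈ S, ω ∈ percolatesAt x) ∧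
          (∀ x ∈ S, ∀ y ∈ S, ω ∈ openConnIn (↑S : Set (Site 3)) x y) ∧
          (n : ℝ) ≤ (S.card : ℝ) ∧
          (((edgeBoundary (zdGraph 3) S).filter (fun e => e ∈ ω)).card : ℝ) ≤
            κ * (S.card : ℝ) ^ ((2 : ℝ) / 3) / Real.log (n : ℝ)} ∪
        {ω | ¬ ω ⊆ (zdGraph 3).edgeSet} := by
      rintro ω ⟨A, hA, hAcard, -, hcut⟩
      by_cases hω : ω ⊆ (zdGraph 3).edgeSet
      · left
        by_contra hnot
        -- outside the bad event, the isoperimetric hypothesis of stub 2 holds at scale `n`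
        have hiso : ∀ S : Finset (Site 3), S ⊆ box 3 n → (∀ x ∈ S, ω ∈ percolatesAt x) →
            (∀ x ∈ S, ∀ y ∈ S, ω ∈ openConnIn (↑S : Set (Site 3)) x y) →
            (n : ℝ) ≤ (S.card : ℝ) →
            κ * (S.card : ℝ) ^ ((2 : ℝ) / 3) / Real.log (n : ℝ) <
              (((edgeBoundary (zdGraph 3) S).filter (fun e => e ∈ ω)).card : ℝ) := by
          intro S hS hperc hconn hsize
          by_contra hle
          exact hnot ⟨S, hS, hperc, hconn, hsize, not_lt.1 hle⟩
        have hmany := hN n hn ω hω hiso A hA hAcard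
        exact absurd hcut (not_le.2 hmany)
      · right
        exact hω
    calc (bondPercolation (zdGraph 3) p).real _
        ≤ (bondPercolation (zdGraph 3) p).real (_ ∪ {ω | ¬ ω ⊆ (zdGraph 3).edgeSet}) :=
          measureReal_mono hsub
      _ ≤ (bondPercolation (zdGraph 3) p).real _ +
            (bondPercolation (zdGraph 3) p).real {ω | ¬ ω ⊆ (zdGraph 3).edgeSet} :=
          measureReal_union_le _ _
      _ = _ := by rw [hnull', add_zero]
  -- squeeze between `0` and the probability of the bad isoperimetry event
  refine tendsto_of_tendsto_of_tendsto_of_le_of_le' tendsto_const_nhds hT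
    (Eventually.of_forall fun n => measureReal_nonneg) ?_
  filter_upwards [eventually_ge_atTop N] with n hn using key n hn

/-! ## §3 Definitional consistency: the registered stubs feed the composition verbatim -/

/-- The registered stub 1, as spelled out, IS the name-keyed statement. -/
theorem connectedIsoperimetry_registered : __Registered.stub_connectedIsoperimetry :=
  stub_connectedIsoperimetry

/-- The registered stub 2, as spelled out, IS the name-keyed statement. -/
theorem denseSetExits_registered : __Registered.stub_denseSetExits := stub_denseSetExits

/- The crux from the two registered stubs (an `example`, so no `sorry`-tainted proof of the crux
enters the environment). -/
example : Summit.CriticalPhenomena.PercolationContinuityZ3.Theses.PercFoamCut.MacroCutLog :=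
  MacroCutLog_of stub_connectedIsoperimetry stub_denseSetExits

end Summit.CriticalPhenomena.PercolationContinuityZ3.Cruxes.MacroCutLog.Birth
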